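import Summits.Ventures.GridStability.Models.WSCC9FaultOnTube9
import Summits.Ventures.GridStability.Bench.WSCC9Deg4ASosgramDinstRoaModel
import Summits.Ventures.GridStability.Models.RecastAngles

/-!
# Bench/WSCC9CctLowerGlue9 — GLUE receptacle of the rider «LOWER-K ∀ t_cl ≤ 9/100 s» (WSCC9, bus-7 fault), modulo ONE union-box inequality

Venture GRIDFUSION (LADDER-GRIDFUSION G1-cct; sos-1 g6 2026-08-27T09:32:50Z Putinar reach: U(T₁) ⊂ {V_deg4 ≤ 1159/1000}
certifiable by ONE degree-2 certificate up to T₁ ≈ 0.09 s), seat gridfusion-model-1.  Same composition as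
`Bench.wscc9_clearing_le_5cycles_returns_of_KSU` (p513111) with the 9/100 tube `WSCC9.faultBus7_tube_9_100` and its union box
`U(9/100)`: `a2 ∈ [7617/25000 − (243/250)(81/20000), 15239/50000 + (48009/1000)(81/20000)] = [0.300743, 0.499216]`,
`a3 ∈ [761/4000 − (243/250)(81/20000), 3807/20000 + (29677/1000)(81/20000)] = [0.186313, 0.310542]`, printed speeds
`x.2 j + ω∞′ ∈ [0, tubeHi9_j·9/100]`.  MODELLED: classical WSCC9 M′ (MV-2 + MV-P + MV-SPD + MV-ω + MV-h12); honest framing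
RULING 27 (B).  [cite: AndersonFouad1977, Example 2.6; Moore1979, §8.1 eq. (8.10)]
-/

noncomputable section

open Real Set Filter Topology

namespace Summit.Ventures.GridStability.Bench

open Summit.Ventures.GridStability.Models Summit.Ventures.GridStability.Models.WSCC9

/-- **«LOWER-K ∀ t_cl ≤ 9/100 s», modulo the named «union box U(9/100) ⊂ S» fact.**  By the 9/100 tube
(`faultBus7_tube_9_100`, all `lo_i > 0`, `ω(0) = 0`) the state cleared at ANY `T ≤ 9/100` lies in the UNION box
`a2 ∈ [a2⁰_lo − hi₁·(81/20000), a2⁰_hi + hi₂·(81/20000)]`, `a3 ∈ [a3⁰_lo − hi₁·(81/20000), a3⁰_hi + hi₃·(81/20000)]`,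
printed speeds `ω_i ∈ [0, hi_i·9/100]` (`hi = tubeHi9`); so ONE kernel inequality `hKSU9` («`V_deg4 ∘ recast ≤ 1159/1000`
on that box» — sos-1's degree-2 Putinar certificate typed by the «K ⊂ S» owner) gives: for every `T ∈ [0, 9/100]`, every
fault-on solution on `[0, T]` from the printed pre-fault point and every post-fault solution from the state cleared at
`T`: no pole slip, `u_i → 0`, speeds `→ 0`.
[cite: AndersonFouad1977, Example 2.6; Moore1979, §8.1 eq. (8.10)] -/
theorem wscc9_clearing_le_9_100_returns_of_KSU9
    (hKSU : ∀ x : ClassicalSwing.State 3,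
      x.1 1 - x.1 0 ∈ Icc (7617 / 25000 - 243 / 250 * (81 / 20000) : ℝ) (15239 / 50000 + 48009 / 1000 * (81 / 20000)) →
      x.1 2 - x.1 0 ∈ Icc (761 / 4000 - 243 / 250 * (81 / 20000) : ℝ) (3807 / 20000 + 29677 / 1000 * (81 / 20000)) →
      (∀ j : Fin 3, x.2 j + (omegaInf : ℝ) ∈ Icc 0 (tubeHi9 j * (9 / 100))) →
      WSCC9.deg4_A_sosgram_Dinst_Vz (WSCC9.deg2_A_SPdampH12_Z postB_SPdamp.angleOf x) ≤ 1159 / 1000)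
    {T : ℝ} (hT0 : 0 ≤ T) (hT : T ≤ 9 / 100)
    {Y : ℝ → ClassicalSwing.State 3} (hY : faultBus7Printed.IsSolutionOn Y (Icc 0 T))
    (hω0 : (Y 0).2 = 0) (ha2 : (Y 0).1 1 - (Y 0).1 0 ∈ a2Window) (ha3 : (Y 0).1 2 - (Y 0).1 0 ∈ a3Window)
    {c : ℝ → ClassicalSwing.State 3} (hc : postB_SPdamp.toModel.IsSolutionOn c (Ici 0))
    (hc0 : c 0 = ((Y T).1, fun j => (Y T).2 j - (omegaInf : ℝ))) :
    (∀ i : Fin 2, ∀ t, 0 ≤ t → |RecastData.u postB_SPdamp.angleOf (c t) i.succ| < π) ∧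
    (∀ i : Fin 2, Tendsto (fun t => RecastData.u postB_SPdamp.angleOf (c t) i.succ) atTop (𝓝 0)) ∧
    (∀ j : Fin 3, Tendsto (fun t => (c t).2 j) atTop (𝓝 0)) := by
  -- (1) the tube at the clearing instant T
  have htube := faultBus7_tube_9_100 hT0 hT hY hω0 ha2 ha3 T ⟨hT0, le_rfl⟩
  obtain ⟨w0l, w0u, d0l, d0u⟩ := htube 0
  obtain ⟨w1l, w1u, d1l, d1u⟩ := htube 1
  obtain ⟨w2l, w2u, d2l, d2u⟩ := htube 2
  obtain ⟨ha2l, ha2u⟩ := ha2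
  obtain ⟨ha3l, ha3u⟩ := ha3
  simp only [tubeLo9, tubeHi9, Matrix.cons_val_zero, Matrix.cons_val_one, Matrix.head_cons, Matrix.cons_val_two,
    Matrix.tail_cons] at w0l w0u d0l d0u w1l w1u d1l d1u w2l w2u d2l d2u
  have hT2 : T ^ 2 ≤ 81 / 10000 := by nlinarith
  have hT2' : 0 ≤ T ^ 2 := sq_nonneg T
  -- linear envelopes at T ≤ 1/12 (all lo_i > 0)
  have e0l : 0 ≤ (Y T).1 0 - (Y 0).1 0 := le_trans (by positivity) d0l
  have e1l : 0 ≤ (Y T).1 1 - (Y 0).1 1 := le_trans (by positivity) d1l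
  have e2l : 0 ≤ (Y T).1 2 - (Y 0).1 2 := le_trans (by positivity) d2l
  have e0u : (Y T).1 0 - (Y 0).1 0 ≤ 243 / 250 * (81 / 20000) := le_trans d0u (by linarith)
  have e1u : (Y T).1 1 - (Y 0).1 1 ≤ 48009 / 1000 * (81 / 20000) := le_trans d1u (by linarith)
  have e2u : (Y T).1 2 - (Y 0).1 2 ≤ 29677 / 1000 * (81 / 20000) := le_trans d2u (by linarith)
  have v0l : 0 ≤ (Y T).2 0 := le_trans (by positivity) w0l
  have v1l : 0 ≤ (Y T).2 1 := le_trans (by positivity) w1l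
  have v2l : 0 ≤ (Y T).2 2 := le_trans (by positivity) w2l
  have v0u : (Y T).2 0 ≤ 243 / 250 * (9 / 100) := le_trans w0u (by linarith)
  have v1u : (Y T).2 1 ≤ 48009 / 1000 * (9 / 100) := le_trans w1u (by linarith)
  have v2u : (Y T).2 2 ≤ 29677 / 1000 * (9 / 100) := le_trans w2u (by linarith)
  -- (2) the cleared state is in the union box, so V ≤ c there
  have hc01 : (c 0).1 = (Y T).1 := by rw [hc0]
  have hc02 : ∀ j, (c 0).2 j + (omegaInf : ℝ) = (Y T).2 j := by
    intro j; rw [hc0]; simp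
  have hV0 : WSCC9.deg4_A_sosgram_Dinst_Vz (WSCC9.deg2_A_SPdampH12_Z postB_SPdamp.angleOf (c 0)) ≤
      1159 / 1000 := by
    refine hKSU (c 0) ?_ ?_ ?_
    · rw [hc01]; constructor <;> norm_num at ha2l ha2u e0u e1u ⊢ <;> linarith
    · rw [hc01]; constructor <;> norm_num at ha3l ha3u e0u e2u ⊢ <;> linarith
    · intro j
      rw [hc02]
      fin_cases j
      · show (Y T).2 0 ∈ Icc 0 (tubeHi9 0 * (9 / 100))
        simp only [tubeHi9, Matrix.cons_val_zero]; exact ⟨v0l, v0u⟩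
      · show (Y T).2 1 ∈ Icc 0 (tubeHi9 1 * (9 / 100))
        simp only [tubeHi9, Matrix.cons_val_one]; exact ⟨v1l, v1u⟩
      · show (Y T).2 2 ∈ Icc 0 (tubeHi9 2 * (9 / 100))
        simp only [tubeHi9, Matrix.cons_val_two, Matrix.tail_cons, Matrix.head_cons]; exact ⟨v2l, v2u⟩
  -- initial window |u_i(0)| < π
  have hacute_s : ∀ i : Fin 3, 0 ≤ postB_SPdamp.s i := by decide +kernel
  have hacute_c : ∀ i : Fin 3, 0 < postB_SPdamp.c i := by decide +kernel
  have hθ : ∀ i : Fin 3, 0 ≤ postB_SPdamp.angleOf i ∧ postB_SPdamp.angleOf i < π / 2 := by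
    intro i
    have h1 : postB_SPdamp.angleOf i = Real.arccos ((postB_SPdamp.c i : ℚ) : ℝ) := by
      unfold RecastData.angleOf; rw [if_pos (hacute_s i)]
    rw [h1]
    exact ⟨Real.arccos_nonneg _, by rw [Real.arccos_lt_pi_div_two]; exact_mod_cast hacute_c i⟩
  have h0win : ∀ i : Fin 2, |RecastData.u postB_SPdamp.angleOf (c 0) i.succ| < π := by
    intro i
    have hπ := Real.pi_gt_three
    unfold RecastData.u
    rw [hc01]
    have hθ0 := hθ 0
    fin_cases i
    · have hθ1 := hθ 1
      show |((Y T).1 1 - (Y T).1 0) - (postB_SPdamp.angleOf 1 - postB_SPdamp.angleOf 0)| < π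
      rw [abs_lt]; norm_num at ha2l ha2u e0u e1u ⊢; constructor <;> linarith
    · have hθ2 := hθ 2
      show |((Y T).1 2 - (Y T).1 0) - (postB_SPdamp.angleOf 2 - postB_SPdamp.angleOf 0)| < π
      rw [abs_lt]; norm_num at ha3l ha3u e0u e2u ⊢; constructor <;> linarith
  -- (3) the deg-4 D-instance ROA at γ = c
  have key := WSCC9.deg4_A_sosgram_Dinst_model_roa postB_SPdamp_eqData (γ := 1159 / 1000) (by norm_num)
    (by unfold WSCC9.deg4_A_sosgram_Dinst_level; norm_num) hc hV0 h0win
  exact ⟨key.2.1, key.2.2.1, key.2.2.2⟩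

end Summit.Ventures.GridStability.Bench

end
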